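import Mathlib.Algebra.MvPolynomial.CommRing
import Mathlib.Algebra.MvPolynomial.Degrees
import Mathlib.Analysis.Convex.Basic
import Mathlib.Analysis.SpecialFunctions.Pow.Real
import Mathlib.Analysis.SpecialFunctions.Log.Basic
import Mathlib.MeasureTheory.Integral.Bochner.Basic
import Mathlib.MeasureTheory.Integral.Bochner.Set
import Mathlib.MeasureTheory.Measure.Lebesgue.Basic
import Mathlib.MeasureTheory.Constructions.Pi
import HarnessLib

/-!
# Carbery–Wright: distributional and `L^q`-norm inequalities for polynomials over convex bodies

Two NAMED FACTS (D-0014: `def … : Prop`, not proved here) from A. Carbery, J. Wright,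
*Distributional and `L^q` norm inequalities for polynomials over convex bodies in `ℝⁿ`*,
Math. Res. Lett. 8 (2001) 233–248 [CarberyWright2001], in the SCALAR case `X = ℝ` and at the two
endpoint exponents the tree currently needs:

* `CarberyWright.supSublevelBound` — Theorem 2 at `q = ∞` (the case due to Brudnyi–Ganzburg 1973,
  as the paper records): with `p^#(x) = |p(x)|^{1/d}` for a real polynomial `p` of degree `≤ d` on
  `ℝⁿ` and `K ⊂ ℝⁿ` a convex body of volume `1`, for every `α > 0`
  `‖p^#‖_{L^∞(K)} · α⁻¹ · |{x ∈ K : p^#(x) ≤ α}| ≤ C n` with an ABSOLUTE constant `C`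
  (printed: `≤ C n (nB(n,q+1))^{1/q}`, and `(nB(n,q+1))^{1/q}` "is to be understood as `1`" at
  `q = ∞`). Equivalently: the sublevel set `{|p| ≤ ε^d sup_K |p|}` has measure `≤ C n ε` — a
  Remez / small-ball inequality with exponent `1/d` in `ε^d`.
* `CarberyWright.supLeGeometricMean` — Theorem 1 at `r = 0`, `q = ∞`:
  `‖p^#‖_∞ ≤ C n ‖p^#‖_0`, `‖p^#‖_0 := exp ∫_K log p^#` (printed constant
  `C [nB(n,q+1)]^{1/q} / [nB(n,r+1)]^{1/r}` with the conventions `1` at `q = ∞` and `1/n` at `r = 0`),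
  i.e. `sup_K |p|^{1/d} ≤ C n · exp((1/d) ∫_K log |p|)`. For `p ≢ 0` on `K` the printed inequality
  asserts in particular `∫_K log |p| > -∞`; since `log |p|` is bounded above on the compact `K` this
  is integrability of `log |p|` on `K`, which is therefore part of the conclusion (so the Bochner
  integral below never takes its junk value `0`).

Both are stated with `∃ C > 0` absolute: "there exists an absolute constant `C` independent of
`p, d, K, n, q, r` and `X`" (Thms 1, 2). Lebesgue measure on `ℝⁿ` is Mathlib's `volume` on
`Fin n → ℝ` (product Lebesgue measure); a convex body is a compact convex set with non-empty
interior; "degree at most `d`" is `MvPolynomial.totalDegree p ≤ d`; `sup_K |p|` is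
`sSup ((fun x => |p x|) '' K)` (attained: `K` compact, non-empty). We ask `1 ≤ d` (the functional
`p^# = |p|^{1/d}` needs it; a polynomial of degree `0` is covered by `d = 1`) and `1 ≤ n`.

Why here: these are the convex-body / Lebesgue templates of the single-link and two-star "flatness"
statements of route `QuantumFields/QCD/PauliWegnerSea` (fibre = product of copies of `SU(3)` with
Haar measure, `F = |det D_W|` a polynomial of bidegree `≤ (6N_f, 6N_f)` in each link):
`supSublevelBound` is the `β = 0`, convex-body model of clause (b) of
`Summit.QuantumFields.QCD.Theses.PauliWegnerSea.TiltedFlatness`, and `supLeGeometricMean` that of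
`Summit.QuantumFields.QCD.Theses.PauliWegnerSea.SingleLinkLogFlatness` (sup ≤ e^{c} · geometric
mean). The route's items are NOT instances of these facts (compact group with Haar measure instead
of a convex body with Lebesgue measure; a `β`-tilted weight in `TiltedFlatness`): transporting them
needs a Remez-type inequality on a compact real-algebraic manifold, which is not vendored here.

Deliberately NOT here: the Banach-space-valued versions, the general `(q, r)` ranges of Theorems 1–2
with the Beta-function constants, the Corollaries, and the results of §§5–6 of the paper.
-/

open MeasureTheory Set

namespace Literature.Analysis.Approximation

/-- **Carbery–Wright, Theorem 2 at `q = ∞` (scalar case; Brudnyi–Ganzburg).** There is an absolute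
constant `C > 0` such that for all `n, d ≥ 1`, every real polynomial `p` on `ℝⁿ` of degree `≤ d`,
every convex body `K ⊂ ℝⁿ` (compact, convex, non-empty interior) of Lebesgue volume `1` and every
`α > 0`:
`(sup_K |p|)^{1/d} · α⁻¹ · vol{x ∈ K : |p(x)|^{1/d} ≤ α} ≤ C · n`.
Printed: "`‖p^#‖_q α^{-1} |{x ∈ K : p^#(x) ≤ α}| ≤ C n (nB(n,q+1))^{1/q}`", `p^#(x) = ‖p(x)‖^{1/d}`,
with `(nB(n,q+1))^{1/q} = 1` at `q = ∞`. Convex-body template for clause (b) of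
`Summit.QuantumFields.QCD.Theses.PauliWegnerSea.TiltedFlatness` at `β = 0` (fact for
`PauliWegnerSea.TiltedFlatness`; the item itself lives on `SU(3)^16` with Haar measure and a tilt and
is not an instance). [cite: CarberyWright2001, Thm 2 (q = ∞)] -/
def CarberyWright.supSublevelBound : Prop :=
  ∃ C : ℝ, 0 < C ∧ ∀ (n d : ℕ), 1 ≤ n → 1 ≤ d →
    ∀ (p : MvPolynomial (Fin n) ℝ), p.totalDegree ≤ d →
    ∀ (K : Set (Fin n → ℝ)), IsCompact K → Convex ℝ K → (interior K).Nonempty → volume K = 1 →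
    ∀ α : ℝ, 0 < α →
      (sSup ((fun x => |MvPolynomial.eval x p|) '' K)) ^ ((1 : ℝ) / d) * α⁻¹ *
          (volume {x | x ∈ K ∧ |MvPolynomial.eval x p| ^ ((1 : ℝ) / d) ≤ α}).toReal
        ≤ C * n

/-- **Carbery–Wright, Theorem 1 at `r = 0`, `q = ∞` (scalar case).** There is an absolute constant
`C > 0` such that for all `n, d ≥ 1`, every real polynomial `p` on `ℝⁿ` of degree `≤ d` and every
convex body `K ⊂ ℝⁿ` of Lebesgue volume `1` on which `p` does not vanish identically
(`sup_K |p| > 0`): `log |p|` is integrable on `K` and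
`(sup_K |p|)^{1/d} ≤ C · n · exp((1/d) ∫_K log |p(x)| dx)`,
i.e. `‖p^#‖_∞ ≤ C n ‖p^#‖_0` with `‖p^#‖_0 = exp ∫_K log p^#` (printed constant
`C [nB(n,q+1)]^{1/q}/[nB(n,r+1)]^{1/r}`, read as `1` at `q = ∞` and `1/n` at `r = 0`). The sup norm of
a polynomial on a convex body exceeds its geometric mean by at most `(Cn)^d`. Convex-body template
for `Summit.QuantumFields.QCD.Theses.PauliWegnerSea.SingleLinkLogFlatness` (fact for
`PauliWegnerSea.SingleLinkLogFlatness`; the item lives on `SU(3)` with Haar measure and is not an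
instance). [cite: CarberyWright2001, Thm 1 (r = 0, q = ∞)] -/
def CarberyWright.supLeGeometricMean : Prop :=
  ∃ C : ℝ, 0 < C ∧ ∀ (n d : ℕ), 1 ≤ n → 1 ≤ d →
    ∀ (p : MvPolynomial (Fin n) ℝ), p.totalDegree ≤ d →
    ∀ (K : Set (Fin n → ℝ)), IsCompact K → Convex ℝ K → (interior K).Nonempty → volume K = 1 →
      0 < sSup ((fun x => |MvPolynomial.eval x p|) '' K) →
        IntegrableOn (fun x => Real.log |MvPolynomial.eval x p|) K volume ∧
        (sSup ((fun x => |MvPolynomial.eval x p|) '' K)) ^ ((1 : ℝ) / d)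
          ≤ C * n * Real.exp ((1 / d : ℝ) * ∫ x in K, Real.log |MvPolynomial.eval x p|)

end Literature.Analysis.Approximation
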